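import Literature.NumberTheory.EllipticCurves.Rank1Residual.Typed.SelmerCardCertificate
import Literature.NumberTheory.EllipticCurves.Rank1Residual.Predicates
import HarnessLib

/-!
# X4 at `p = 3`, analytic rank `0`: the `3`-SELMER CERTIFICATE consumer — `#Sel^(3)(E/ℚ) = 1` and
# `3 ∤ #Ш_an` give `BSD(E,3)` with NO image / Tamagawa / Manin / tower hypothesis (cell `b2b-bsdres`,
# team n1011, sub-target T-a5: the EXOTIC and TAM-DEFECT₂♭@3 residue rows of N11)

HONEST FRAMING (cell `b2b-bsdres`, run/shared/lean/b2b/bsd-rank1-residual/, verbatim in every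
file): the goal of the cell is to DELETE the COMBINATION-SHAPED residual classes of the
Birch–Swinnerton-Dyer formula for ALL analytic-rank `≤ 1` elliptic curves over `ℚ` — "full BSD
formula for every rank `≤ 1` curve in class `C`" assembled STRICTLY from published theorems — so
that the rank-`≤ 1` remainder becomes exactly the CONSTRUCTION-SHAPED classes, which are TYPED
(missing-input `Prop`s), NOT attempted. This is not "finishing BSD". Team n1011 (N10 / N11):
prove what is provable now; shrink each hard class to its core with data; no claim beyond stated
classes; research routes; census output = EVIDENCE, never a Literature fact. The label of X4 is
UNCHANGED by this file; nothing is booked. Theorems only (no definition, no named fact).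

## What and why

On N11 (X4 ∧ `r_an = 0` ∧ `p = 3` ∧ surj(3)) the kernel end-state
`Additive.x4SharpUnitFree_iff_lower_and_residues_sharp` (p246578) / `x4SharpThree_iff_residue_sharp`
leaves, besides the LOWER half, two UPPER-half residues on which no printed Euler-system route
applies: the **EXOTIC** rows (`ρ̄_{E,3}` onto but `ρ̄_{E,9}` not onto — Elkies' 9-deficient `3`-adic
image; outside Kato's (12.5.2), and — sibling file `GaloisImage/ExoticThreeAdicImage.lean` — even
outside hypothesis (im)) and the **TAM-DEFECT₂♭@3** rows (`v₃(c₃) + 2 ≤ ord₃ ∏ c_ℓ` off the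
`(G-ord, e = 2)` locus). On such a row with `3 ∤ #Ш_an(E)` the `3`-part of BSD is nevertheless a
ONE-LINE consequence of a `3`-DESCENT certificate: `#Sel^(3)(E/ℚ) = 1` forces `Ш(E/ℚ)[3] = 0`
(the tree's PROVED fundamental exact sequence `0 → E(ℚ)/3E(ℚ) → Sel^(3) → Ш[3] → 0`,
`Typed.noPTorsion_of_card_selmerGroup_eq_pow_rank`, Silverman *AEC* X.4.2(a)), hence
`Ш(E/ℚ)[3^∞] = 0`, `ord₃ #Ш = 0 = ord₃ #Ш_an`, i.e. Miller's `BSD(E,3)` given Gross–Zagier–Kolyvagin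
for rank and finiteness (`Typed.bsdp_of_card_selmerGroup_eq_pow_analyticRank` with `3 ^ r_an = 1`).
The consumer is CLASS-FREE — no `ClassX4`, no surjectivity, no tower, no Tamagawa, no Manin datum,
no Kato / Kim / Kim–Nakamura / Delbourgo fact — so it serves the EXOTIC rows, the TAM-DEFECT₂♭@3
rows and every other analytic-rank-`0` row with `3 ∤ #Ш_an` alike; the certificate `#Sel₃ = 1` is a
per-curve computed input (a `3`-descent in EXACT mode; team n1011 request Q2, two engines), so this
is a per-pair instrument, not a class theorem. (The extra binder "`E(ℚ)[3] = 0`" of the sub-target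
text is implied by `#Sel^(3) = 1` — `E(ℚ)/3E(ℚ) ↪ Sel^(3)` — and is therefore not carried.)

* `X4RankZero.noThreeTorsion_sha_of_card_selmerThree_eq_one` — `r_an = 0 ∧ #Sel₃ = 1 ⇒ Ш(E/ℚ)[3] = 0`;
* `X4RankZero.bsdp_three_of_card_selmerThree_eq_one` — `r_an = 0 ∧ #Ш_an = q, ord₃ q = 0 ∧
  #Sel₃ = 1 ⇒ BSD(E,3)` (class-free);
* `X4RankZero.bsdp_three_exotic_of_card_selmerThree_eq_one` — the same displayed on the EXOTIC rows
  of N11 (the class binders are documentation only and are underscore-named: nothing is silently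
  used or dropped).

References: J. H. Silverman, *AEC* 2nd ed., Thm. X.4.2(a); R. L. Miller, LMS J. Comput. Math. 14
(2011) §1, Def. 1.1 [Miller2011LMS]; N. D. Elkies, arXiv:math/0612734 (2006) (the EXOTIC image);
cell files HOME/cells/n1011/PLAN.md §2 T-a5, REFEREE-1.md §1–§3.
-/

noncomputable section

open scoped Classical

open WeierstrassCurve Literature.NumberTheory.EllipticCurves
  Literature.NumberTheory.EllipticCurves.Rank1Residual
  Literature.NumberTheory.EllipticCurves.Rank1Residual.Typed

namespace Summit.BirchSwinnertonDyer.Rank1Residual.Additive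

variable (W : WeierstrassCurve ℚ) [W.IsElliptic]

/-- **`r_an = 0` and `#Sel^(3)(E/ℚ) = 1` force `Ш(E/ℚ)[3] = 0`** (any `E/ℚ`; Gross–Zagier–Kolyvagin
`hGZK` turns `r_an = 0` into `rank_ℤ E(ℚ) = 0`, and `3 ^ 0 = 1 = #Sel^(3)` is the hypothesis of the
tree's `Typed.noPTorsion_of_card_selmerGroup_eq_pow_rank`, the PROVED fundamental exact sequence of
`3`-descent). Class-free; a per-curve certificate consumer. [cite: SilvermanAEC2009, Thm X.4.2(a)] -/
theorem X4RankZero.noThreeTorsion_sha_of_card_selmerThree_eq_one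
    (hGZK : rank_eq_analyticRank_of_analyticRank_le_one) (hr : W.analyticRank = 0)
    (hsel : Nat.card (W.selmerGroup (3 : ℤ)) = 1) :
    ∀ x : W.sha, (3 : ℤ) • x = 0 → x = 0 := by
  haveI : Fact (Nat.Prime 3) := ⟨Nat.prime_three⟩
  have hrank : W.mordellWeilRank = 0 := by
    rw [(hGZK W (by rw [hr]; exact zero_le_one)).1, hr]
  exact noPTorsion_of_card_selmerGroup_eq_pow_rank W 3 (by rw [hrank, pow_zero]; exact_mod_cast hsel)

/-- **The `3`-Selmer certificate consumer, class-free.** For `E = W/ℚ` of analytic rank `0` with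
`#Ш(E)_an = q`, `ord₃ q = 0`, the certificate `#Sel^(3)(E/ℚ) = 1` gives Miller's `BSD(E,3)`
(`Typed.bsdp_of_card_selmerGroup_eq_pow_analyticRank` with `3 ^ r_an = 3 ^ 0 = 1`; GZK `hGZK` for
rank and finiteness). NO image / reduction-type / Tamagawa / Manin hypothesis: this is the per-pair
closing shape of the EXOTIC and TAM-DEFECT₂♭@3 residue rows of N11 (and of any analytic-rank-`0` row
with `3 ∤ #Ш_an`). The certificate is a computed input (two engines per cell rule R5); not a class
theorem. [cite: Miller2011LMS, §1 and Def. 1.1] [cite: SilvermanAEC2009, Thm X.4.2(a)] -/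
theorem X4RankZero.bsdp_three_of_card_selmerThree_eq_one
    (hGZK : rank_eq_analyticRank_of_analyticRank_le_one) (hr : W.analyticRank = 0)
    {q : ℚ} (hq : shaAn W = (q : ℂ)) (hv : padicValRat 3 q = 0)
    (hsel : Nat.card (W.selmerGroup (3 : ℤ)) = 1) : BSDp W 3 := by
  haveI : Fact (Nat.Prime 3) := ⟨Nat.prime_three⟩
  exact bsdp_of_card_selmerGroup_eq_pow_analyticRank W 3 hGZK (by rw [hr]; exact zero_le_one) hq hv
    (by rw [hr, pow_zero]; exact_mod_cast hsel)

/-- **The EXOTIC rows of N11 close per pair by a `3`-Selmer certificate.** Displayed form of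
`X4RankZero.bsdp_three_of_card_selmerThree_eq_one` on class X4 at `3`, analytic rank `0`, `ρ̄_{E,3}`
onto, potentially good (`0 ≤ ord₃ j`), WITHOUT `3`-adic tower surjectivity (the EXOTIC residue of
`x4SharpThree_iff_residue_sharp`: Elkies' 9-deficient image, where (12.5.2) and even (im) fail —
`GaloisImage/ExoticThreeAdicImage.lean`): `#Sel^(3)(E/ℚ) = 1 ∧ 3 ∤ #Ш_an ⇒ BSD(E,3)`. The five
class binders are DOCUMENTATION ONLY (underscore-named; the proof is the class-free one) — recorded
so that the N11 corner theorem can cite the residue by name. Not a class theorem.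
[cite: Miller2011LMS, §1 and Def. 1.1] [cite: SilvermanAEC2009, Thm X.4.2(a)] -/
theorem X4RankZero.bsdp_three_exotic_of_card_selmerThree_eq_one
    (hGZK : rank_eq_analyticRank_of_analyticRank_le_one) (hr : W.analyticRank = 0)
    (_hX : ClassX4 W 3) (_hs : Surj W 3) (_hj : 0 ≤ padicValRat 3 W.j)
    (_hexotic : ¬ ∀ n : ℕ, W.HasSurjectiveModNGaloisRep (3 ^ n : ℕ))
    {q : ℚ} (hq : shaAn W = (q : ℂ)) (hv : padicValRat 3 q = 0)
    (hsel : Nat.card (W.selmerGroup (3 : ℤ)) = 1) : BSDp W 3 :=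
  X4RankZero.bsdp_three_of_card_selmerThree_eq_one W hGZK hr hq hv hsel

end Summit.BirchSwinnertonDyer.Rank1Residual.Additive

end
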